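import Mathlib.Analysis.SpecialFunctions.Complex.Log
import Mathlib.Algebra.Field.GeomSum
import Mathlib.Algebra.BigOperators.Field
import Mathlib.Data.Nat.Prime.Infinite
import Mathlib.RingTheory.Int.Basic
import Mathlib.Algebra.Order.BigOperators.Group.Finset

/-!
# Crux `LatticeODLROOffHalfFilling` — ladder line, stub `stub_groundSector_of_twist`: the rigidity lemma

Route BECGroundStateSOS, crux stmt-AtomisticToContinuum-11033, line `Sketch`. Pure trigonometry behind the
stub `stub_groundSector_of_twist` ("twist positivity forces the half-filled ground sector"):

* `sum_cos_two_pi_div` — the discrete orthogonality `Σ_{r<p} cos(2πrn/p) = p·[n = 0]` for `|n| < p`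
  (geometric sum of a nontrivial `p`-th root of unity);
* `sum_cos_mul_cos_two_pi_div` — its product form via `2 cos a cos b = cos(a+b) + cos(a−b)`;
* `cos_two_pi_div_ne_one` — `cos(2πrM/p) ≠ 1` for a prime `p ∤ r, M`;
* `weights_eq_zero_of_sum_cos_nonneg` — **rigidity**: nonnegative weights `d_i` with integer frequencies
  `m_i`, sector sums `c_M = Σ_{m_i = M} d_i ∈ {0, 1}` with `c_{−M} = c_M`, and
  `F(θ) = Σ_i d_i cos(θ m_i) ≥ 0` for all `θ`, vanish off the sector `m_i = 0`. Proof: for `c_{M₀} = 1`,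
  `M₀ ≠ 0`, and a prime `p > 2 max|m_i|`, `p > Σ d_i`, sampling `θ_r = 2πr/p` gives
  `Σ_r F(θ_r)(1 − cos(M₀θ_r)) = p c_0 − p ≤ 0` with nonnegative terms, so `F(θ_r) = 0` for `0 < r < p` and
  `Σ_i d_i = F(0) = Σ_r F(θ_r) = p c_0 = p`, contradiction.
All [folklore].
-/

noncomputable section

namespace Summit.AtomisticToContinuum.BoseEinsteinCondensation.Theorems.LatticeODLROOffHalfFilling.Ladder

open Finset Real
open scoped BigOperators

/-- **Discrete orthogonality**: `Σ_{r<p} cos(2π r n / p) = p` if `n = 0` and `0` if `0 < |n| < p`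
(the powers of the nontrivial `p`-th root of unity `e^{2πin/p}` sum to zero). [folklore] -/
theorem sum_cos_two_pi_div {p : ℕ} (hp : 0 < p) {n : ℤ} (hn : |n| < p) :
    ∑ r ∈ range p, Real.cos (2 * π * r * n / p) = if n = 0 then (p : ℝ) else 0 := by
  split_ifs with h0
  · simp [h0]
  · have hp0 : (p : ℂ) ≠ 0 := by exact_mod_cast hp.ne'
    set z : ℂ := Complex.exp (2 * π * Complex.I * n / p) with hz
    -- each cosine is the real part of a power of `z`
    have hterm : ∀ r : ℕ, Real.cos (2 * π * r * n / p) = (z ^ r).re := by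
      intro r
      rw [hz, ← Complex.exp_nat_mul, ← Complex.exp_ofReal_mul_I_re]
      congr 2
      push_cast
      ring
    have hzp : z ^ p = 1 := by
      rw [hz, ← Complex.exp_nat_mul, Complex.exp_eq_one_iff]
      refine ⟨n, ?_⟩
      field_simp
    have hz1 : z ≠ 1 := by
      intro h1
      rw [hz, Complex.exp_eq_one_iff] at h1
      obtain ⟨N, hN⟩ := h1
      have hI : (2 * π * Complex.I : ℂ) ≠ 0 := by simp [Real.pi_ne_zero, Complex.I_ne_zero]
      rw [div_eq_iff hp0] at hN
      have h2 : (n : ℂ) * (2 * π * Complex.I) = (N * p : ℂ) * (2 * π * Complex.I) := by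
        linear_combination hN
      have h2' : (n : ℂ) = N * p := mul_right_cancel₀ hI h2
      have h3 : n = N * p := by exact_mod_cast h2'
      have hdvd : (p : ℤ) ∣ n := ⟨N, by rw [h3]; ring⟩
      exact h0 (Int.eq_zero_of_abs_lt_dvd hdvd hn)
    simp_rw [hterm]
    rw [← Complex.re_sum, geom_sum_eq hz1, hzp, sub_self, zero_div, Complex.zero_re]

/-- The product form: `Σ_{r<p} cos(2πra/p) cos(2πrb/p) = (p/2)([a + b = 0] + [a = b])` for
`|a + b|, |a − b| < p`. [folklore] -/
theorem sum_cos_mul_cos_two_pi_div {p : ℕ} (hp : 0 < p) {a b : ℤ} (hab : |a + b| < p)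
    (hab' : |a - b| < p) :
    ∑ r ∈ range p, Real.cos (2 * π * r * a / p) * Real.cos (2 * π * r * b / p) =
      ((if a + b = 0 then (p : ℝ) else 0) + (if a - b = 0 then (p : ℝ) else 0)) / 2 := by
  have hterm : ∀ r : ℕ, Real.cos (2 * π * r * a / p) * Real.cos (2 * π * r * b / p) =
      (Real.cos (2 * π * r * ((a + b : ℤ) : ℝ) / p) + Real.cos (2 * π * r * ((a - b : ℤ) : ℝ) / p)) / 2 := by
    intro r
    have e1 : 2 * π * r * ((a + b : ℤ) : ℝ) / p = 2 * π * r * a / p + 2 * π * r * b / p := by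
      push_cast; ring
    have e2 : 2 * π * r * ((a - b : ℤ) : ℝ) / p = 2 * π * r * a / p - 2 * π * r * b / p := by
      push_cast; ring
    rw [e1, e2, Real.cos_add, Real.cos_sub]
    ring
  simp_rw [hterm]
  rw [← sum_div, sum_add_distrib, sum_cos_two_pi_div hp hab, sum_cos_two_pi_div hp hab']

/-- `cos(2π r M / p) ≠ 1` when the prime `p` divides neither `r` nor `M`. [folklore] -/
theorem cos_two_pi_div_ne_one {p : ℕ} (hp : p.Prime) {r : ℕ} (hr0 : 0 < r) (hrp : r < p) {M : ℤ}
    (hM0 : M ≠ 0) (hMp : |M| < p) : Real.cos (2 * π * r * M / p) ≠ 1 := by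
  intro h
  rw [Real.cos_eq_one_iff] at h
  obtain ⟨N, hN⟩ := h
  have hp0 : (p : ℝ) ≠ 0 := by exact_mod_cast hp.ne_zero
  have hπ : (2 * π : ℝ) ≠ 0 := by positivity
  rw [eq_div_iff hp0] at hN
  have h1 : (N : ℝ) * p = r * M := by
    apply mul_left_cancel₀ hπ
    linear_combination hN
  have h2 : (N : ℤ) * p = r * M := by exact_mod_cast h1
  have hdvd : (p : ℤ) ∣ (r : ℤ) * M := ⟨N, by rw [← h2]; ring⟩
  rcases Int.Prime.dvd_mul' hp hdvd with h | h
  · have : p ∣ r := Int.natCast_dvd_natCast.mp h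
    exact absurd (Nat.eq_zero_of_dvd_of_lt this hrp) hr0.ne'
  · exact hM0 (Int.eq_zero_of_abs_lt_dvd h hMp)

/-- **Rigidity of `{0,1}`-valued even nonnegative cosine sums.** Nonnegative weights `d_i` with integer
frequencies `m_i` whose sector sums `c_M = Σ_{m_i = M} d_i` lie in `{0, 1}` and are even in `M`, and whose
cosine transform `F(θ) = Σ_i d_i cos(θ m_i)` is nonnegative for every real `θ`, vanish off the sector
`m_i = 0`. [folklore] -/
theorem weights_eq_zero_of_sum_cos_nonneg {ι : Type} [Fintype ι] (d : ι → ℝ) (m : ι → ℤ)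
    (hnn : ∀ i, 0 ≤ d i)
    (h01 : ∀ M : ℤ, (∑ i ∈ univ.filter (fun i => m i = M), d i) = 0 ∨
      (∑ i ∈ univ.filter (fun i => m i = M), d i) = 1)
    (hsym : ∀ M : ℤ, (∑ i ∈ univ.filter (fun i => m i = -M), d i) =
      ∑ i ∈ univ.filter (fun i => m i = M), d i)
    (hpos : ∀ θ : ℝ, 0 ≤ ∑ i, d i * Real.cos (θ * m i)) :
    ∀ i, m i ≠ 0 → d i = 0 := by
  classical
  -- a bound on the frequencies
  obtain ⟨K, hK⟩ : ∃ K : ℕ, ∀ i, |m i| ≤ K := by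
    refine ⟨univ.sup fun i => (m i).natAbs, fun i => ?_⟩
    have h : (m i).natAbs ≤ univ.sup fun i => (m i).natAbs := le_sup (f := fun i => (m i).natAbs) (mem_univ i)
    rw [Int.abs_eq_natAbs]
    exact_mod_cast h
  -- the sector sums
  set c : ℤ → ℝ := fun M => ∑ i ∈ univ.filter (fun i => m i = M), d i with hc
  have hc_le : ∀ M, c M ≤ 1 := fun M => by
    rcases h01 M with h | h
    · simp only [hc]; rw [h]; norm_num
    · simp only [hc]; rw [h]
  have hc_ge : ∀ i, d i ≤ c (m i) := fun i =>
    single_le_sum (f := d) (fun j _ => hnn j) (mem_filter.mpr ⟨mem_univ i, rfl⟩)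
  intro i₀ hm₀
  by_contra hd₀
  have hd₀pos : 0 < d i₀ := lt_of_le_of_ne (hnn i₀) (Ne.symm hd₀)
  set M₀ : ℤ := m i₀ with hM₀
  have hcM₀ : c M₀ = 1 := by
    rcases h01 M₀ with h | h
    · exfalso
      have := hc_ge i₀
      rw [← hM₀] at this
      simp only [hc] at this h
      linarith
    · exact h
  have hcnegM₀ : c (-M₀) = 1 := by
    have := hsym M₀
    simp only [hc] at hcM₀ ⊢
    rw [this, hcM₀]
  -- a large prime
  obtain ⟨p, hple, hp⟩ := Nat.exists_infinite_primes (2 * K + ⌈∑ i, d i⌉₊ + 2)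
  have hp0 : 0 < p := hp.pos
  have hp0' : (p : ℝ) ≠ 0 := by exact_mod_cast hp0.ne'
  have hKp : 2 * (K : ℤ) < p := by
    have : 2 * K < p := by omega
    exact_mod_cast this
  have hsum_lt : ∑ i, d i < p := by
    have h1 : ∑ i, d i ≤ ⌈∑ i, d i⌉₊ := Nat.le_ceil _
    have h2 : (⌈∑ i, d i⌉₊ : ℝ) < p := by
      have : ⌈∑ i, d i⌉₊ < p := by omega
      exact_mod_cast this
    linarith
  have habs1 : ∀ i, |m i| < p := fun i => by
    have := hK i
    have hK' : (K : ℤ) < p := by linarith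
    linarith
  have habs2 : ∀ i, |m i + M₀| < p := fun i => by
    have h1 := abs_add_le (m i) M₀
    have := hK i
    have := hK i₀
    rw [← hM₀] at this
    linarith
  have habs3 : ∀ i, |m i - M₀| < p := fun i => by
    have h1 := abs_sub (m i) M₀
    have := hK i
    have := hK i₀
    rw [← hM₀] at this
    linarith
  -- the sampled sums `F(θ_r)`
  set F : ℕ → ℝ := fun r => ∑ i, d i * Real.cos (2 * π * r * m i / p) with hF
  have hFnn : ∀ r, 0 ≤ F r := fun r => by
    have h := hpos (2 * π * r / p)
    have e : ∀ i, 2 * π * r / p * (m i : ℝ) = 2 * π * r * m i / p := fun i => by ring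
    simp_rw [e] at h
    exact h
  -- `Σ_r F(θ_r) = p c_0`
  have hS1 : ∑ r ∈ range p, F r = p * c 0 := by
    simp only [hF]
    rw [sum_comm]
    have h : ∀ i, ∑ r ∈ range p, d i * Real.cos (2 * π * r * m i / p) =
        d i * (if m i = 0 then (p : ℝ) else 0) := fun i => by
      rw [← mul_sum, sum_cos_two_pi_div hp0 (habs1 i)]
    simp_rw [h]
    simp only [hc, sum_filter, mul_sum]
    refine sum_congr rfl fun i _ => ?_
    split_ifs <;> ring
  -- `Σ_r F(θ_r) cos(M₀ θ_r) = p`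
  have hS2 : ∑ r ∈ range p, F r * Real.cos (2 * π * r * M₀ / p) = p := by
    simp only [hF]
    simp_rw [sum_mul]
    rw [sum_comm]
    have h : ∀ i, ∑ r ∈ range p, d i * Real.cos (2 * π * r * m i / p) * Real.cos (2 * π * r * M₀ / p) =
        d i * (((if m i + M₀ = 0 then (p : ℝ) else 0) + (if m i - M₀ = 0 then (p : ℝ) else 0)) / 2) :=
      fun i => by
      simp_rw [mul_assoc (d i)]
      rw [← mul_sum, sum_cos_mul_cos_two_pi_div hp0 (habs2 i) (habs3 i)]
    simp_rw [h]
    have e : ∀ i, d i * (((if m i + M₀ = 0 then (p : ℝ) else 0) + (if m i - M₀ = 0 then (p : ℝ) else 0)) / 2) =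
        (p / 2) * (if m i = -M₀ then d i else 0) + (p / 2) * (if m i = M₀ then d i else 0) := fun i => by
      have e1 : (m i + M₀ = 0) ↔ (m i = -M₀) := by constructor <;> intro h <;> linarith
      have e2 : (m i - M₀ = 0) ↔ (m i = M₀) := sub_eq_zero
      simp only [e1, e2]
      split_ifs <;> ring
    simp_rw [e]
    rw [sum_add_distrib, ← mul_sum, ← mul_sum, ← sum_filter, ← sum_filter]
    change (p / 2) * c (-M₀) + (p / 2) * c M₀ = p
    rw [hcM₀, hcnegM₀]
    ring
  -- the nonnegative sum `Σ_r F(θ_r)(1 − cos(M₀ θ_r)) = p c_0 − p ≤ 0`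
  have hterm_nn : ∀ r ∈ range p, 0 ≤ F r * (1 - Real.cos (2 * π * r * M₀ / p)) := fun r _ =>
    mul_nonneg (hFnn r) (by linarith [Real.cos_le_one (2 * π * r * M₀ / p)])
  have hA : ∑ r ∈ range p, F r * (1 - Real.cos (2 * π * r * M₀ / p)) = p * c 0 - p := by
    simp_rw [mul_sub, mul_one]
    rw [sum_sub_distrib, hS1, hS2]
  have hA0 : ∑ r ∈ range p, F r * (1 - Real.cos (2 * π * r * M₀ / p)) = 0 := by
    apply le_antisymm
    · rw [hA]
      have := hc_le 0
      have hp' : (0 : ℝ) < p := by exact_mod_cast hp0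
      nlinarith
    · exact sum_nonneg hterm_nn
  have hc0 : c 0 = 1 := by
    have h := hA0
    rw [hA] at h
    have hp' : (0 : ℝ) < p := by exact_mod_cast hp0
    have : (p : ℝ) * (c 0 - 1) = 0 := by linarith
    rcases mul_eq_zero.mp this with h' | h'
    · exact absurd h' hp0'
    · linarith
  -- every term vanishes, hence `F(θ_r) = 0` for `0 < r < p`
  have hzero := (sum_eq_zero_iff_of_nonneg hterm_nn).mp hA0
  have hFr : ∀ r ∈ range p, r ≠ 0 → F r = 0 := by
    intro r hr hr0
    have h := hzero r hr
    have hM₀p : |M₀| < p := by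
      have := hK i₀
      rw [← hM₀] at this
      have hK' : (K : ℤ) < p := by linarith
      linarith
    have hne := cos_two_pi_div_ne_one hp (Nat.pos_of_ne_zero hr0) (mem_range.mp hr) hm₀ hM₀p
    rcases mul_eq_zero.mp h with h' | h'
    · exact h'
    · exact absurd (by linarith : Real.cos (2 * π * r * M₀ / p) = 1) hne
  -- so `Σ_r F(θ_r) = F(0) = Σ_i d_i = p`, contradiction
  have hS1' : ∑ r ∈ range p, F r = ∑ i, d i := by
    rw [sum_eq_single 0 (fun r hr hr0 => hFr r hr hr0) (fun h => absurd (mem_range.mpr hp0) h)]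
    simp [hF]
  rw [hS1', hc0, mul_one] at hS1
  linarith
end Summit.AtomisticToContinuum.BoseEinsteinCondensation.Theorems.LatticeODLROOffHalfFilling.Ladder

end
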